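import Literature.MathematicalPhysics.QuantumFieldTheory.YangMillsOS
import Literature.MathematicalPhysics.QuantumFieldTheory.BalabanBanachStep
import Literature.MathematicalPhysics.QuantumFieldTheory.LatticeGaugeProofs
import Literature.MathematicalPhysics.AQFT.OSAxiomsSchwinger
import Literature.MathematicalPhysics.QuantumLattice.SchwartzTensor
import HarnessLib

/-!
# Soft OS-assembly toolkit III: the lattice `n`-point DISTRIBUTION of one species

Helper file for stub `stub_assembly` of crux `OSLegsFromFemtoAndGap` (stmt-QuantumFields-9367, line
`dlr-collar-transfer`).  The tree's `latticeSchwinger` is a number attached to an `n`-tuple of REAL one-point test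
functions; the OS data are continuous linear functionals on `𝓢((ℝ⁴)ⁿ, ℂ)`.  The bridge is the finite atomic
functional
  `latticeDist ρ β L a O m n : 𝓢((Fin n → ℝ⁴), ℂ) →L[ℂ] ℂ`,
  `F ↦ ∑_{x ∈ (box L)ⁿ} W(x) · F(a x₁, …, a xₙ)`, `W(x) = ∫ ∏ᵢ (O(τ_{xᵢ} Ũ) − m) dμ_{β, 2L+1}(U)`
(`torusMoment`), for which we prove:
* `latticeDist_apply` — the defining formula;
* `latticeSchwinger_eq_latticeDist` — on a tensor `F = f₁ ⊗ ⋯ ⊗ fₙ` of real test functions, the tree's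
  `latticeSchwinger` of the constant species string `(s, …, s)` at step `k` of ANY scheme equals
  `(c_s(k) a_k⁴)ⁿ · latticeDist r.ρ (β_k) (L_k) (a_k) s.F (m_s(k)) n F` — so with the canonical normalisation
  `c_s(k) = a_k⁻⁴` the convergence clause of `IsYangMillsFor` / `PreOS` for the curvature strings is literally
  convergence of these functionals on real off-diagonal tensors, and uniform E0′-type bounds / exact lattice
  symmetries / reflection positivity can be stated and proved for `latticeDist` (toolkit IV ff.).
References: Glimm–Jaffe 1987 §6.1; Osterwalder–Schrader 1973 §2; Jaffe–Witten 2000 §6.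
-/

noncomputable section

open scoped SchwartzMap BigOperators
open MeasureTheory Filter Topology
open Literature.MathematicalPhysics.QuantumFieldTheory Literature.MathematicalPhysics.QuantumLattice
open Literature.MathematicalPhysics.AQFT
open Literature.Probability.LatticeModels (box Site)

namespace Summit.QuantumFields.YangMills.Theorems.OSLegsFromFemtoAndGap

variable {G : Type} [Group G] [TopologicalSpace G] [IsTopologicalGroup G] [CompactSpace G]
  [MeasurableSpace G] [BorelSpace G]

/-- **Centred torus `n`-point moment** `W(x) = ∫ ∏ᵢ (O(τ_{xᵢ} Ũ) − m) dμ_{β,2L+1}(U)` of the observable `O` of the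
infinite lattice, read through the periodic lift of the torus of side `2L+1`, at the sites `x₁, …, xₙ ∈ ℤ⁴`,
with additive normalisation `m`. -/
def torusMoment {N : ℕ} (ρ : G →* Matrix (Fin N) (Fin N) ℂ) (β : ℝ) (L : ℕ) (O : LGConfig 4 G → ℝ) (m : ℝ)
    {n : ℕ} (x : Fin n → Site 4) : ℝ :=
  ∫ U, ∏ i, (O (configShift (-(x i)) (torusLift (2 * L + 1) U)) - m)
    ∂(wilsonMeasure (d := 4) (L := 2 * L + 1) ρ β)

/-- **The lattice `n`-point distribution** of the observable `O` at spacing `a` on the torus of half-side `L`: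
the finite atomic continuous linear functional `F ↦ ∑_{x ∈ (box L)ⁿ} W(x) F(a x)` on `𝓢((Fin n → ℝ⁴), ℂ)`
(Riemann normalisation `a⁴ⁿ` and field renormalisation `c` NOT included: with `c = a⁻⁴` they cancel). -/
def latticeDist {N : ℕ} (ρ : G →* Matrix (Fin N) (Fin N) ℂ) (β : ℝ) (L : ℕ) (a : ℝ) (O : LGConfig 4 G → ℝ)
    (m : ℝ) (n : ℕ) : 𝓢((Fin n → EuclideanSpace ℝ (Fin 4)), ℂ) →L[ℂ] ℂ :=
  ∑ x ∈ Fintype.piFinset (fun _ : Fin n => box 4 L),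
    ((torusMoment ρ β L O m x : ℝ) : ℂ) •
      LabelledSchwingerFamily.evalAt (fun i => a • siteToE (x i))

/-- Unfolding `latticeDist`: `latticeDist … F = ∑ₓ W(x) F(a x)`. -/
theorem latticeDist_apply {N : ℕ} (ρ : G →* Matrix (Fin N) (Fin N) ℂ) (β : ℝ) (L : ℕ) (a : ℝ)
    (O : LGConfig 4 G → ℝ) (m : ℝ) (n : ℕ) (F : 𝓢((Fin n → EuclideanSpace ℝ (Fin 4)), ℂ)) :
    latticeDist ρ β L a O m n F =
      ∑ x ∈ Fintype.piFinset (fun _ : Fin n => box 4 L),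
        ((torusMoment ρ β L O m x : ℝ) : ℂ) * F (fun i => a • siteToE (x i)) := by
  simp only [latticeDist, FunLike.coe_sum, Finset.sum_apply, FunLike.coe_smul,
    Pi.smul_apply, LabelledSchwingerFamily.evalAt_apply, smul_eq_mul]

section Scheme

omit [TopologicalSpace G] [IsTopologicalGroup G] [CompactSpace G] [BorelSpace G] [Group G] in
/-- The smeared lattice field of a scheme at step `k`, expanded: `Φ(f)(V) = c a⁴ ∑ₓ f(a x)(O(τₓV) − m)`. -/
theorem smearedLatticeField_eq_mul_sum (O : LGConfig 4 G → ℝ) (Λ : Finset (Site 4)) (a c m : ℝ)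
    (f : 𝓢(EuclideanSpace ℝ (Fin 4), ℝ)) (V : LGConfig 4 G) :
    smearedLatticeField O Λ a c m f V = (c * a ^ 4) * ∑ x ∈ Λ, f (a • siteToE x) * (O (configShift (-x) V) - m) :=
  rfl

/-- Integrability of the centred products under the (probability) Wilson measure for a bounded measurable
observable. -/
theorem integrable_prod_obs (r : LatticeRep G) (β : ℝ) (L : ℕ) (s : YMSpecies G) (m : ℝ) {n : ℕ}
    (x : Fin n → Site 4) :
    Integrable (fun U : GaugeConfig 4 (2 * L + 1) G =>
        ∏ i, (s.F (configShift (-(x i)) (torusLift (2 * L + 1) U)) - m))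
      (wilsonMeasure (d := 4) (L := 2 * L + 1) r.ρ β) := by
  haveI := isProbabilityMeasure_wilsonMeasure (d := 4) (L := 2 * L + 1) r.ρ r.continuous β
  obtain ⟨C, hC⟩ := s.bounded
  have hmeas : ∀ i, Measurable fun U : GaugeConfig 4 (2 * L + 1) G =>
      s.F (configShift (-(x i)) (torusLift (2 * L + 1) U)) - m := fun i =>
    (s.measurable.comp ((configShift _).measurable.comp (measurable_torusLift _))).sub measurable_const
  refine Integrable.of_bound (C := (|C| + |m|) ^ n)
    (Finset.measurable_prod _ fun i _ => hmeas i).aestronglyMeasurable ?_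
  refine Eventually.of_forall fun U => ?_
  rw [Real.norm_eq_abs, Finset.abs_prod]
  calc ∏ i, |s.F (configShift (-(x i)) (torusLift (2 * L + 1) U)) - m|
      ≤ ∏ _i : Fin n, (|C| + |m|) := Finset.prod_le_prod (fun _ _ => abs_nonneg _) fun i _ =>
        (abs_sub _ _).trans (add_le_add ((hC _).trans (le_abs_self C)) le_rfl)
    _ = (|C| + |m|) ^ n := by simp

/-- **`latticeSchwinger` on real tensors is `latticeDist`.**  For any scheme `sch`, any species `s`, step `k`,
arity `n`, real test functions `f` and any tensor witness `F = ⊗ᵢ fᵢ`: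
`latticeSchwinger r.ρ sch (·.F) k n (s,…,s) f = (c_s(k) · a_k⁴)ⁿ · latticeDist r.ρ β_k L_k a_k s.F m_s(k) n F`. -/
theorem latticeSchwinger_eq_latticeDist (r : LatticeRep G) (sch : SpeciesScheme (YMSpecies G)) (s : YMSpecies G)
    (k n : ℕ) (f : Fin n → 𝓢(EuclideanSpace ℝ (Fin 4), ℝ)) (F : 𝓢((Fin n → EuclideanSpace ℝ (Fin 4)), ℂ))
    (hF : IsTensorOf F (fun i => ofRealTest (f i))) :
    ((latticeSchwinger r.ρ sch (fun t => t.F) k n (fun _ => s) f : ℝ) : ℂ) =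
      (((sch.c s k * (sch.a k) ^ 4) ^ n : ℝ) : ℂ) *
        latticeDist r.ρ (sch.β k) (sch.L k) (sch.a k) s.F (sch.m s k) n F := by
  classical
  -- expand the product of sums under the integral
  have hprod : ∀ U : GaugeConfig 4 (sch.side k) G,
      ∏ i, smearedLatticeField s.F (box 4 (sch.L k)) (sch.a k) (sch.c s k) (sch.m s k) (f i)
          (torusLift (sch.side k) U) =
        (sch.c s k * sch.a k ^ 4) ^ n * ∑ x ∈ Fintype.piFinset (fun _ : Fin n => box 4 (sch.L k)),
          (∏ i, f i (sch.a k • siteToE (x i))) *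
            ∏ i, (s.F (configShift (-(x i)) (torusLift (sch.side k) U)) - sch.m s k) := by
    intro U
    simp only [smearedLatticeField_eq_mul_sum]
    rw [Finset.prod_mul_distrib, Finset.prod_const, Finset.card_univ, Fintype.card_fin]
    congr 1
    rw [Finset.prod_univ_sum]
    refine Finset.sum_congr rfl fun x _ => ?_
    rw [← Finset.prod_mul_distrib]
  have hfun : (fun U : GaugeConfig 4 (sch.side k) G =>
      ∏ i, smearedLatticeField ((fun t : YMSpecies G => t.F) ((fun _ : Fin n => s) i)) (box 4 (sch.L k)) (sch.a k)
        (sch.c ((fun _ : Fin n => s) i) k) (sch.m ((fun _ : Fin n => s) i) k) (f i) (torusLift (sch.side k) U)) =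
      fun U => (sch.c s k * sch.a k ^ 4) ^ n * ∑ x ∈ Fintype.piFinset (fun _ : Fin n => box 4 (sch.L k)),
          (∏ i, f i (sch.a k • siteToE (x i))) *
            ∏ i, (s.F (configShift (-(x i)) (torusLift (sch.side k) U)) - sch.m s k) :=
    funext hprod
  have hint : ∀ x : Fin n → Site 4, Integrable (fun U : GaugeConfig 4 (sch.side k) G =>
      ∏ i, (s.F (configShift (-(x i)) (torusLift (sch.side k) U)) - sch.m s k))
      (wilsonMeasure (d := 4) (L := sch.side k) r.ρ (sch.β k)) := fun x =>
    integrable_prod_obs r (sch.β k) (sch.L k) s (sch.m s k) x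
  unfold latticeSchwinger
  rw [hfun, integral_const_mul]
  rw [integral_finsetSum _ (fun x _ => (hint x).const_mul _)]
  simp only [integral_const_mul]
  -- now the right-hand side
  rw [latticeDist_apply]
  push_cast
  simp only [Finset.mul_sum]
  refine Finset.sum_congr rfl fun x _ => ?_
  have hFx : F (fun i => sch.a k • siteToE (x i)) = ∏ i, ((f i (sch.a k • siteToE (x i)) : ℝ) : ℂ) := by
    rw [hF]
    simp [ofRealTest_apply]
  rw [hFx]
  have hW : (∫ U : GaugeConfig 4 (sch.side k) G,
      ∏ i, (s.F (configShift (-(x i)) (torusLift (sch.side k) U)) - sch.m s k)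
        ∂(wilsonMeasure (d := 4) (L := sch.side k) r.ρ (sch.β k))) =
      torusMoment r.ρ (sch.β k) (sch.L k) s.F (sch.m s k) x := rfl
  rw [hW]
  ring

end Scheme

end Summit.QuantumFields.YangMills.Theorems.OSLegsFromFemtoAndGap

end
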